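import Mathlib
import Summits.ValiantsHypothesis.ValiantsHypothesis.Theorems.RigidityForcesSymmetryRankRigidMinimalReprLaplaceFourDefs
import Summits.ValiantsHypothesis.ValiantsHypothesis.Theorems.RigidityForcesSymmetryRankRigidMinimalReprLaplaceFourContraction
import Summits.ValiantsHypothesis.ValiantsHypothesis.Theorems.RigidityForcesSymmetryRankRigidMinimalReprLaplaceFourLineCore
import Summits.ValiantsHypothesis.ValiantsHypothesis.Theorems.RigidityForcesSymmetryRankRigidMinimalReprLaplaceFourLineKills
import Summits.ValiantsHypothesis.ValiantsHypothesis.Theorems.RigidityForcesSymmetryRankRigidMinimalReprLaplaceFourLineE3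
import Summits.ValiantsHypothesis.ValiantsHypothesis.Theorems.RigidityForcesSymmetryRankRigidMinimalReprLaplaceFourProfile311
import Summits.ValiantsHypothesis.ValiantsHypothesis.Theorems.RigidityForcesSymmetryRankRigidMinimalReprLaplaceFourProfile211sCore

/-!
# The border profile `slice + (2,1,1)` of `LaplaceOptimal 4` is impossible exactly
# (crux `RankRigidMinimalRepr`, stmt-ValiantsHypothesis-18034, route `RigidityForcesSymmetry`)

`profile_211s`: the permutation pattern `P₄` is NOT of the form
`f(v₀)H(v₁,v₂,v₃) + g₀(v₀,v₁)h₀(v₂,v₃) + g₁(v₀,v₁)h₁(v₂,v₃) + b(v₀,v₂)b′(v₁,v₃) + c(v₀,v₃)c′(v₁,v₂)`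
(one slice on slot `0`, two pair terms on `01|23`, one on `02|13`, one on `03|12`; Laplace weight `22 < 24`).
Together with `profile_311` this settles the last two LINE-type border classes.

Proof.  `e3_dichotomy_id`: after a letter relabelling the arrays are in the normal form of `matching_shape` AND the
noise vanishes along the matching line `ψ_φ = (φ₀,-φ₁,0,0)`, i.e. `(f₀φ₀ - f₁φ₁)·H_φ ∈ W := span{h₀,h₁}`.
* If `f₀ ≠ 0` or `f₁ ≠ 0` then every `H_y ∈ W`, the slice term is itself two pair terms on `01|23` with the same `h_t`,
  and `profile_311` applies.  If `f = 0`, `profile_311` applies directly.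
* Otherwise `f₀ = f₁ = 0 ≠ (f₂,f₃)`: the matrices `D(e₀,e₁)` and `f₃D′(e₂,e_w) - f₂D′(e₃,e_w)` (`w < 4`) lie in the
  plane `W`; they are the five explicit matrices of `planar_core`, which forces `f₂ = f₃ = 0`.

HONEST FRAMING: a finite tensor statement toward `LaplaceOptimal 4` (rung `TiedTorusBound 3`); the crux stays OPEN;
nothing here bears on `VP ≠ VNP`.
-/

set_option autoImplicit false

-- the mandated summit-side namespace repeats a component by design (single-problem summit)
set_option linter.dupNamespace false

namespace Summit.ValiantsHypothesis.ValiantsHypothesis.Theorems.RigidityForcesSymmetryRankRigidMinimalRepr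

namespace LaplaceFourLine

open Module Matrix LaplaceFourContraction

/-! ### §0 Entries of the elementary contractions -/

/-- `Q(e_z,e_w)_{ij} = 1` iff `z,w,i,j` are pairwise distinct (and `0` otherwise). -/
theorem contract_single_single (z w i j : Fin 4) :
    contract₀₁ permPattern₄ (Pi.single z (1 : ℂ)) (Pi.single w 1) i j =
      if i ≠ j ∧ z ≠ w ∧ z ≠ i ∧ z ≠ j ∧ w ≠ i ∧ w ≠ j then 1 else 0 := by
  rw [contract_permPattern_entries]
  fin_cases z <;> fin_cases w <;> fin_cases i <;> fin_cases j <;> simp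

/-- Entries of `D′(e_z,e_w) = Q(e_z,e_w) - (Be_z)(B′e_w)ᵀ - (C′e_w)(Ce_z)ᵀ`. -/
theorem dPrime_single_apply (b b' c c' : Fin 4 → Fin 4 → ℂ) (z w i j : Fin 4) :
    (contract₀₁ permPattern₄ (Pi.single z 1) (Pi.single w 1) -
      vecMulVec (fun i => ∑ x, (Pi.single z (1 : ℂ) : Fin 4 → ℂ) x * b x i)
        (fun j => ∑ y, (Pi.single w (1 : ℂ) : Fin 4 → ℂ) y * b' y j) -
      vecMulVec (fun i => ∑ y, (Pi.single w (1 : ℂ) : Fin 4 → ℂ) y * c' y i)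
        (fun j => ∑ x, (Pi.single z (1 : ℂ) : Fin 4 → ℂ) x * c x j)) i j =
      (if i ≠ j ∧ z ≠ w ∧ z ≠ i ∧ z ≠ j ∧ w ≠ i ∧ w ≠ j then 1 else 0) - b z i * b' w j - c' w i * c z j := by
  rw [← contract_single_single]
  simp [vecMulVec_apply, Pi.single_apply, Finset.sum_ite_eq']

/-- The contraction of a decomposition of the profile minus its rank-one and slice parts lies in the plane of the two
noise matrices. -/
theorem d_mem_plane (f : Fin 4 → ℂ) (H : Fin 4 → Fin 4 → Fin 4 → ℂ) (g₀ h₀ g₁ h₁ b b' c c' : Fin 4 → Fin 4 → ℂ)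
    (hsum : ∀ v, permPattern₄ v =
      (f (v 0) * H (v 1) (v 2) (v 3) + g₀ (v 0) (v 1) * h₀ (v 2) (v 3) + g₁ (v 0) (v 1) * h₁ (v 2) (v 3)) +
        b (v 0) (v 2) * b' (v 1) (v 3) + c (v 0) (v 3) * c' (v 1) (v 2))
    (ψ φ : Fin 4 → ℂ) :
    contract₀₁ permPattern₄ ψ φ -
      vecMulVec (fun i => ∑ x, ψ x * b x i) (fun j => ∑ y, φ y * b' y j) -
      vecMulVec (fun i => ∑ y, φ y * c' y i) (fun j => ∑ x, ψ x * c x j) -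
      (∑ x, f x * ψ x) • (Matrix.of fun i j => ∑ y, φ y * H y i j) ∈
      Submodule.span ℂ (Set.range ![Matrix.of h₀, Matrix.of h₁]) := by
  have hQ : contract₀₁ permPattern₄ ψ φ =
      (∑ x, f x * ψ x) • (Matrix.of fun i j => ∑ y, φ y * H y i j) + (∑ x, ∑ y, ψ x * φ y * g₀ x y) • Matrix.of h₀ +
        (∑ x, ∑ y, ψ x * φ y * g₁ x y) • Matrix.of h₁ +
        vecMulVec (fun i => ∑ x, ψ x * b x i) (fun j => ∑ y, φ y * b' y j) +
        vecMulVec (fun i => ∑ y, φ y * c' y i) (fun j => ∑ x, ψ x * c x j) := by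
    rw [contract_congr hsum]
    have hsplit : (fun v => (f (v 0) * H (v 1) (v 2) (v 3) + g₀ (v 0) (v 1) * h₀ (v 2) (v 3) +
        g₁ (v 0) (v 1) * h₁ (v 2) (v 3)) + b (v 0) (v 2) * b' (v 1) (v 3) + c (v 0) (v 3) * c' (v 1) (v 2)) =
        fun v => ∑ k : Fin 5, (![fun v => f (v 0) * H (v 1) (v 2) (v 3), fun v => g₀ (v 0) (v 1) * h₀ (v 2) (v 3),
          fun v => g₁ (v 0) (v 1) * h₁ (v 2) (v 3), fun v => b (v 0) (v 2) * b' (v 1) (v 3),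
          fun v => c (v 0) (v 3) * c' (v 1) (v 2)] : Fin 5 → (Fin 4 → Fin 4) → ℂ) k v := by
      funext v
      simp only [Fin.sum_univ_five, Matrix.cons_val_zero, Matrix.cons_val_one, Matrix.head_cons, Matrix.cons_val_two,
        Matrix.tail_cons, Matrix.cons_val_three, Matrix.cons_val_four]
    rw [contract_congr (fun v => congrFun hsplit v), contract_sum, Fin.sum_univ_five]
    simp only [Matrix.cons_val_zero, Matrix.cons_val_one, Matrix.head_cons, Matrix.cons_val_two, Matrix.tail_cons,
      Matrix.cons_val_three, Matrix.cons_val_four]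
    rw [contract_slice0, contract_pair01, contract_pair01, contract_pair02, contract_pair03]
  rw [hQ, show ∀ (A B₀ B₁ C D : Matrix (Fin 4) (Fin 4) ℂ), A + B₀ + B₁ + C + D - C - D - A = B₀ + B₁ from
    fun _ _ _ _ _ => by abel]
  exact Submodule.add_mem _ (Submodule.smul_mem _ _ (Submodule.subset_span ⟨0, rfl⟩))
    (Submodule.smul_mem _ _ (Submodule.subset_span ⟨1, rfl⟩))

/-! ### §1 The planar case `f₀ = f₁ = 0 ≠ (f₂,f₃)` -/

/-- The profile in normal form with `f₀ = f₁ = 0 ≠ (f₂, f₃)`: contradiction (via `planar_core`); `Dm z w`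
stands for `D′(e_z,e_w) = Q(e_z,e_w) - (Be_z)(B′e_w)ᵀ - (C′e_w)(Ce_z)ᵀ`, given through its entries. -/
theorem profile_211s_planar (f : Fin 4 → ℂ) (Hm : Fin 4 → Matrix (Fin 4) (Fin 4) ℂ) (b b' c c' : Fin 4 → Fin 4 → ℂ)
    (W : Submodule ℂ (Matrix (Fin 4) (Fin 4) ℂ)) (hW : finrank ℂ W ≤ 2) (Dm : Fin 4 → Fin 4 → Matrix (Fin 4) (Fin 4) ℂ)
    (hDm_apply : ∀ z w i j, Dm z w i j =
      (if i ≠ j ∧ z ≠ w ∧ z ≠ i ∧ z ≠ j ∧ w ≠ i ∧ w ≠ j then 1 else 0) - b z i * b' w j - c' w i * c z j)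
    (hDW : ∀ z w : Fin 4, Dm z w - f z • Hm w ∈ W)
    (hb : b 0 0 = 0 ∧ b 1 1 = 0 ∧ b 1 0 = b 0 1 ∧ b 0 2 = 0 ∧ b 0 3 = 0 ∧ b 1 2 = 0 ∧ b 1 3 = 0)
    (hc : c 0 0 = 0 ∧ c 1 1 = 0 ∧ c 1 0 = c 0 1 ∧ c 0 2 = 0 ∧ c 0 3 = 0 ∧ c 1 2 = 0 ∧ c 1 3 = 0)
    (hb' : b' 0 0 = 0 ∧ b' 1 1 = 0 ∧ b' 0 1 = -b' 1 0 ∧ b' 2 0 = 0 ∧ b' 3 0 = 0 ∧ b' 2 1 = 0 ∧ b' 3 1 = 0 ∧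
      b' 0 2 = 0 ∧ b' 1 2 = 0 ∧ b' 2 2 = 0 ∧ b' 0 3 = 0 ∧ b' 1 3 = 0 ∧ b' 3 3 = 0 ∧ b' 3 2 = b' 2 3)
    (hc' : c' 0 0 = 0 ∧ c' 1 1 = 0 ∧ c' 0 1 = -c' 1 0 ∧ c' 2 0 = 0 ∧ c' 3 0 = 0 ∧ c' 2 1 = 0 ∧ c' 3 1 = 0 ∧
      c' 0 2 = 0 ∧ c' 1 2 = 0 ∧ c' 2 2 = 0 ∧ c' 0 3 = 0 ∧ c' 1 3 = 0 ∧ c' 3 3 = 0 ∧ c' 3 2 = c' 2 3)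
    (r3 : b 0 1 * b' 1 0 + c 0 1 * c' 1 0 = 0) (hf0 : f 0 = 0) (hf23 : ¬(f 2 = 0 ∧ f 3 = 0)) :
    False := by
  obtain ⟨b00, b11, b10, b02, b03, b12, b13⟩ := hb
  obtain ⟨c00, c11, c10, c02, c03, c12, c13⟩ := hc
  obtain ⟨bp00, bp11, bp01, bp20, bp30, bp21, bp31, bp02, bp12, bp22, bp03, bp13, bp33, bp32⟩ := hb'
  obtain ⟨cp00, cp11, cp01, cp20, cp30, cp21, cp31, cp02, cp12, cp22, cp03, cp13, cp33, cp32⟩ := hc'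
  -- `M = D′(e₀,e₁) ∈ W` and `V_w = f₃ D′(e₂,e_w) - f₂ D′(e₃,e_w) ∈ W`
  have hMW : Dm 0 1 ∈ W := by simpa [hf0] using hDW 0 1
  have hVW : ∀ w, f 3 • Dm 2 w - f 2 • Dm 3 w ∈ W := by
    intro w
    rw [show ∀ (A B Hw : Matrix (Fin 4) (Fin 4) ℂ) (p q : ℂ), p • A - q • B = p • (A - q • Hw) - q • (B - p • Hw)
      from fun A B Hw p q => by rw [smul_sub, smul_sub, smul_smul, smul_smul, mul_comm q p]; abel]
    exact W.sub_mem (W.smul_mem _ (hDW 2 w)) (W.smul_mem _ (hDW 3 w))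
  -- closed forms of the arrays (rows `2, 3` of `b, c` are free)
  obtain ⟨u, hu⟩ : ∃ u : Fin 4 → ℂ, ∀ j, b 2 j = u j := ⟨_, fun _ => rfl⟩
  obtain ⟨u', hu'⟩ : ∃ u : Fin 4 → ℂ, ∀ j, b 3 j = u j := ⟨_, fun _ => rfl⟩
  obtain ⟨w₂, hw₂⟩ : ∃ u : Fin 4 → ℂ, ∀ j, c 2 j = u j := ⟨_, fun _ => rfl⟩
  obtain ⟨w₃, hw₃⟩ : ∃ u : Fin 4 → ℂ, ∀ j, c 3 j = u j := ⟨_, fun _ => rfl⟩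
  obtain ⟨l, hl⟩ : ∃ x, b 0 1 = x := ⟨_, rfl⟩
  obtain ⟨β, hβ⟩ : ∃ x, b' 1 0 = x := ⟨_, rfl⟩
  obtain ⟨σ, hσ⟩ : ∃ x, b' 2 3 = x := ⟨_, rfl⟩
  obtain ⟨l', hl'⟩ : ∃ x, c 0 1 = x := ⟨_, rfl⟩
  obtain ⟨γ, hγ⟩ : ∃ x, c' 1 0 = x := ⟨_, rfl⟩
  obtain ⟨τ, hτ⟩ : ∃ x, c' 2 3 = x := ⟨_, rfl⟩
  have hbM : ∀ i j, b i j = !![0, l, 0, 0; l, 0, 0, 0; u 0, u 1, u 2, u 3; u' 0, u' 1, u' 2, u' 3] i j := by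
    intro i j
    fin_cases i <;> fin_cases j <;> simp [b00, b11, b10, b02, b03, b12, b13, hl, hu, hu']
  have hb'M : ∀ i j, b' i j = !![0, -β, 0, 0; β, 0, 0, 0; 0, 0, 0, σ; 0, 0, σ, 0] i j := by
    intro i j
    fin_cases i <;> fin_cases j <;>
      simp [bp00, bp11, bp01, bp20, bp30, bp21, bp31, bp02, bp12, bp22, bp03, bp13, bp33, bp32, hβ, hσ]
  have hcM : ∀ i j, c i j = !![0, l', 0, 0; l', 0, 0, 0; w₂ 0, w₂ 1, w₂ 2, w₂ 3; w₃ 0, w₃ 1, w₃ 2, w₃ 3] i j := by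
    intro i j
    fin_cases i <;> fin_cases j <;> simp [c00, c11, c10, c02, c03, c12, c13, hl', hw₂, hw₃]
  have hc'M : ∀ i j, c' i j = !![0, -γ, 0, 0; γ, 0, 0, 0; 0, 0, 0, τ; 0, 0, τ, 0] i j := by
    intro i j
    fin_cases i <;> fin_cases j <;>
      simp [cp00, cp11, cp01, cp20, cp30, cp21, cp31, cp02, cp12, cp22, cp03, cp13, cp33, cp32, hγ, hτ]
  have r3' : l * β + l' * γ = 0 := by rw [← hl, ← hβ, ← hl', ← hγ]; exact r3
  -- the five matrices, written out
  refine planar_core W hW l β γ l' σ τ (f 2) (f 3) (fun i => f 3 * u i - f 2 * u' i)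
    (fun i => f 3 * w₂ i - f 2 * w₃ i) r3' hf23 ?_ ?_ ?_ ?_ ?_
  · convert hMW using 1
    ext i j
    fin_cases i <;> fin_cases j <;> simp [hDm_apply, hbM, hb'M, hcM, hc'M]
  · convert hVW 0 using 1
    ext i j
    fin_cases i <;> fin_cases j <;> simp [hDm_apply, hbM, hb'M, hcM, hc'M] <;> ring
  · convert hVW 1 using 1
    ext i j
    fin_cases i <;> fin_cases j <;> simp [hDm_apply, hbM, hb'M, hcM, hc'M] <;> ring
  · convert hVW 2 using 1
    ext i j
    fin_cases i <;> fin_cases j <;> simp [hDm_apply, hbM, hb'M, hcM, hc'M] <;> ring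
  · convert hVW 3 using 1
    ext i j
    fin_cases i <;> fin_cases j <;> simp [hDm_apply, hbM, hb'M, hcM, hc'M] <;> ring

/-! ### §2 The profile given the normal form and the identity -/

/-- The profile `slice + (2,1,1)` with the arrays in the normal form of `matching_shape` and the noise vanishing along
the matching line: contradiction. -/
theorem profile_211s_of_shape (f : Fin 4 → ℂ) (H : Fin 4 → Fin 4 → Fin 4 → ℂ)
    (g₀ h₀ g₁ h₁ b b' c c' : Fin 4 → Fin 4 → ℂ)
    (hsum : ∀ v, permPattern₄ v =
      (f (v 0) * H (v 1) (v 2) (v 3) + g₀ (v 0) (v 1) * h₀ (v 2) (v 3) + g₁ (v 0) (v 1) * h₁ (v 2) (v 3)) +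
        b (v 0) (v 2) * b' (v 1) (v 3) + c (v 0) (v 3) * c' (v 1) (v 2))
    (hid : ∀ φ : Fin 4 → ℂ,
      contract₀₁ (fun v => f (v 0) * H (v 1) (v 2) (v 3)) (lineVec (Sum.inr (0, 1)) φ) φ +
      contract₀₁ (fun v => g₀ (v 0) (v 1) * h₀ (v 2) (v 3)) (lineVec (Sum.inr (0, 1)) φ) φ +
      contract₀₁ (fun v => g₁ (v 0) (v 1) * h₁ (v 2) (v 3)) (lineVec (Sum.inr (0, 1)) φ) φ = 0)
    (hb : b 0 0 = 0 ∧ b 1 1 = 0 ∧ b 1 0 = b 0 1 ∧ b 0 2 = 0 ∧ b 0 3 = 0 ∧ b 1 2 = 0 ∧ b 1 3 = 0)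
    (hc : c 0 0 = 0 ∧ c 1 1 = 0 ∧ c 1 0 = c 0 1 ∧ c 0 2 = 0 ∧ c 0 3 = 0 ∧ c 1 2 = 0 ∧ c 1 3 = 0)
    (hb' : b' 0 0 = 0 ∧ b' 1 1 = 0 ∧ b' 0 1 = -b' 1 0 ∧ b' 2 0 = 0 ∧ b' 3 0 = 0 ∧ b' 2 1 = 0 ∧ b' 3 1 = 0 ∧
      b' 0 2 = 0 ∧ b' 1 2 = 0 ∧ b' 2 2 = 0 ∧ b' 0 3 = 0 ∧ b' 1 3 = 0 ∧ b' 3 3 = 0 ∧ b' 3 2 = b' 2 3)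
    (hc' : c' 0 0 = 0 ∧ c' 1 1 = 0 ∧ c' 0 1 = -c' 1 0 ∧ c' 2 0 = 0 ∧ c' 3 0 = 0 ∧ c' 2 1 = 0 ∧ c' 3 1 = 0 ∧
      c' 0 2 = 0 ∧ c' 1 2 = 0 ∧ c' 2 2 = 0 ∧ c' 0 3 = 0 ∧ c' 1 3 = 0 ∧ c' 3 3 = 0 ∧ c' 3 2 = c' 2 3)
    (hrel : b 0 1 * b' 2 3 = 1 ∧ c 0 1 * c' 2 3 = 1 ∧ b 0 1 * b' 1 0 + c 0 1 * c' 1 0 = 0) : False := by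
  classical
  -- the plane of the two noise matrices and the slice matrices `H_y`
  let W : Submodule ℂ (Matrix (Fin 4) (Fin 4) ℂ) := Submodule.span ℂ (Set.range ![Matrix.of h₀, Matrix.of h₁])
  have hW : finrank ℂ W ≤ 2 := (finrank_range_le_card _).trans (by simp)
  have h₀W : Matrix.of h₀ ∈ W := Submodule.subset_span ⟨0, rfl⟩
  have h₁W : Matrix.of h₁ ∈ W := Submodule.subset_span ⟨1, rfl⟩
  let Hm : Fin 4 → Matrix (Fin 4) (Fin 4) ℂ := fun y => Matrix.of fun i j => H y i j
  have hHφ : ∀ φ : Fin 4 → ℂ, (Matrix.of fun i j => ∑ y, φ y * H y i j) = ∑ y, φ y • Hm y := by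
    intro φ; ext i j; simp [Hm, Matrix.sum_apply]
  have hD := d_mem_plane f H g₀ h₀ g₁ h₁ b b' c c' hsum
  -- the identity: `(f₀φ₀ - f₁φ₁) • H_φ ∈ W`
  have hidW : ∀ φ : Fin 4 → ℂ, (f 0 * φ 0 - f 1 * φ 1) • (∑ y, φ y • Hm y) ∈ W := by
    intro φ
    have h := hid φ
    rw [contract_slice0, contract_pair01, contract_pair01, hHφ, lineVec_matching] at h
    have hs : (∑ x, f x * (![φ 0, -φ 1, 0, 0] : Fin 4 → ℂ) x) = f 0 * φ 0 - f 1 * φ 1 := by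
      simp [Fin.sum_univ_four]; ring
    rw [hs, add_assoc, add_eq_zero_iff_eq_neg] at h
    rw [h]
    exact W.neg_mem (W.add_mem (W.smul_mem _ h₀W) (W.smul_mem _ h₁W))
  -- Case B: `f₀ ≠ 0` or `f₁ ≠ 0`: every `H_y` lies in `W`, reduce to `profile_311`
  by_cases hf01 : f 0 = 0 ∧ f 1 = 0
  swap
  · have hHW : ∀ y, Hm y ∈ W := by
      -- a base index `a ∈ {0,1}` with `f a ≠ 0` and the scalar `f₀φ₀ - f₁φ₁` along `e_a + s e_y`
      have main : ∀ a : Fin 4, (a = 0 ∨ a = 1) → f a ≠ 0 → ∀ y, Hm y ∈ W := by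
        intro a ha hfa
        have sc : ∀ (y : Fin 4) (s : ℂ), f 0 * (Pi.single a (1 : ℂ) + s • Pi.single y (1 : ℂ) : Fin 4 → ℂ) 0 -
            f 1 * (Pi.single a (1 : ℂ) + s • Pi.single y (1 : ℂ) : Fin 4 → ℂ) 1 =
            (if a = 0 then f 0 else -f 1) + s * (f 0 * (Pi.single y (1 : ℂ) : Fin 4 → ℂ) 0 -
              f 1 * (Pi.single y (1 : ℂ) : Fin 4 → ℂ) 1) := by
          intro y s
          rcases ha with rfl | rfl <;> simp <;> ring
        have hv : ∀ (y : Fin 4) (s : ℂ),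
            (∑ y', (Pi.single a (1 : ℂ) + s • Pi.single y (1 : ℂ) : Fin 4 → ℂ) y' • Hm y') = Hm a + s • Hm y := by
          intro y s
          simp [add_smul, Finset.sum_add_distrib, Pi.single_apply]
        have hfa' : (if a = 0 then f 0 else -f 1) ≠ 0 := by
          rcases ha with rfl | rfl <;> simpa using hfa
        have haW : Hm a ∈ W := by
          have := hidW (Pi.single a 1 + (0 : ℂ) • Pi.single a 1)
          rw [sc, hv] at this
          simp only [zero_mul, add_zero, zero_smul] at this
          exact (W.smul_mem_iff hfa').1 this
        intro y
        obtain ⟨s, hs0, hsc⟩ : ∃ s : ℂ, s ≠ 0 ∧ (if a = 0 then f 0 else -f 1) + s * (f 0 * (Pi.single y (1 : ℂ) :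
            Fin 4 → ℂ) 0 - f 1 * (Pi.single y (1 : ℂ) : Fin 4 → ℂ) 1) ≠ 0 := by
          by_cases h1 : (if a = 0 then f 0 else -f 1) + 1 * (f 0 * (Pi.single y (1 : ℂ) : Fin 4 → ℂ) 0 -
              f 1 * (Pi.single y (1 : ℂ) : Fin 4 → ℂ) 1) = 0
          · refine ⟨2, two_ne_zero, fun h2 => hfa' ?_⟩
            linear_combination 2 * h1 - h2
          · exact ⟨1, one_ne_zero, h1⟩
        have := hidW (Pi.single a 1 + s • Pi.single y 1)
        rw [sc, hv] at this
        have h2 := (W.smul_mem_iff hsc).1 this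
        have h3 : s • Hm y ∈ W := by simpa using W.sub_mem h2 haW
        exact (W.smul_mem_iff hs0).1 h3
      by_cases h0 : f 0 = 0
      · exact main 1 (Or.inr rfl) (fun h1 => hf01 ⟨h0, h1⟩)
      · exact main 0 (Or.inl rfl) h0
    -- coefficients of `H_y` in the plane
    choose η hη using fun y => (Submodule.mem_span_range_iff_exists_fun ℂ).1 (hHW y)
    have hHy : ∀ y i j, H y i j = η y 0 * h₀ i j + η y 1 * h₁ i j := by
      intro y i j
      have := congrFun (congrFun (hη y) i) j
      simp [Fin.sum_univ_two, Matrix.sum_apply, Hm] at this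
      linear_combination -this
    refine profile_311 ![fun x y => g₀ x y + f x * η y 0, fun x y => g₁ x y + f x * η y 1, fun _ _ => 0]
      ![h₀, h₁, fun _ _ => 0] b b' c c' fun v => ?_
    rw [hsum v, hHy]
    simp [Fin.sum_univ_three]
    ring
  obtain ⟨hf0, hf1⟩ := hf01
  -- Case `f = 0`: `profile_311` directly
  by_cases hf23 : f 2 = 0 ∧ f 3 = 0
  · have hf : ∀ x, f x = 0 := by
      intro x; fin_cases x <;> simp [hf0, hf1, hf23.1, hf23.2]
    refine profile_311 ![g₀, g₁, fun _ _ => 0] ![h₀, h₁, fun _ _ => 0] b b' c c' fun v => ?_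
    rw [hsum v, hf]
    simp [Fin.sum_univ_three]
  -- Case A: the planar core
  have hHe : ∀ y, (∑ y', (Pi.single y (1 : ℂ) : Fin 4 → ℂ) y' • Hm y') = Hm y := by
    intro y; simp [Pi.single_apply]
  refine profile_211s_planar f Hm b b' c c' W hW (fun z w =>
    contract₀₁ permPattern₄ (Pi.single z 1) (Pi.single w 1) -
      vecMulVec (fun i => ∑ x, (Pi.single z (1 : ℂ) : Fin 4 → ℂ) x * b x i)
        (fun j => ∑ y, (Pi.single w (1 : ℂ) : Fin 4 → ℂ) y * b' y j) -
      vecMulVec (fun i => ∑ y, (Pi.single w (1 : ℂ) : Fin 4 → ℂ) y * c' y i)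
        (fun j => ∑ x, (Pi.single z (1 : ℂ) : Fin 4 → ℂ) x * c x j))
    (fun z w i j => dPrime_single_apply b b' c c' z w i j) (fun z w => ?_) hb hc hb' hc' hrel.2.2 hf0 hf23
  have := hD (Pi.single z 1) (Pi.single w 1)
  rwa [hHφ, hHe, show (∑ x, f x * (Pi.single z (1 : ℂ) : Fin 4 → ℂ) x) = f z by simp [Pi.single_apply]] at this

/-! ### §3 The profile `slice + (2,1,1)` -/

/-- **The border profile `slice + (2,1,1)` is impossible exactly**: `P₄` is not a slice term on slot `0` plus two pair
terms on `01|23`, one on `02|13` and one on `03|12`. -/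
theorem profile_211s (f : Fin 4 → ℂ) (H : Fin 4 → Fin 4 → Fin 4 → ℂ) (g₀ h₀ g₁ h₁ b b' c c' : Fin 4 → Fin 4 → ℂ)
    (hsum : ∀ v, permPattern₄ v =
      (f (v 0) * H (v 1) (v 2) (v 3) + g₀ (v 0) (v 1) * h₀ (v 2) (v 3) + g₁ (v 0) (v 1) * h₁ (v 2) (v 3)) +
        b (v 0) (v 2) * b' (v 1) (v 3) + c (v 0) (v 3) * c' (v 1) (v 2)) : False := by
  classical
  -- the noise family
  let Xn : Fin 3 → (Fin 4 → Fin 4) → ℂ := ![fun v => f (v 0) * H (v 1) (v 2) (v 3),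
    fun v => g₀ (v 0) (v 1) * h₀ (v 2) (v 3), fun v => g₁ (v 0) (v 1) * h₁ (v 2) (v 3)]
  let Sn : Fin 3 → Finset (Fin 4) := ![{0}, {0, 1}, {0, 1}]
  have hXn : ∀ t ∈ (Finset.univ : Finset (Fin 3)), IsSplitTerm (Sn t) (Xn t) := by
    intro t _
    fin_cases t
    · exact isSplitTerm_slice0 f H
    · exact isSplitTerm_pair01 g₀ h₀
    · exact isSplitTerm_pair01 g₁ h₁
  have hSn : ∀ t ∈ (Finset.univ : Finset (Fin 3)), Sn t = {0} ∨ Sn t = {0, 1} := by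
    intro t _; fin_cases t <;> simp [Sn]
  have hsum' : ∀ v, permPattern₄ v = (∑ t ∈ (Finset.univ : Finset (Fin 3)), Xn t v) +
      b (v 0) (v 2) * b' (v 1) (v 3) + c (v 0) (v 3) * c' (v 1) (v 2) := by
    intro v
    rw [hsum v, Fin.sum_univ_three]
    rfl
  obtain ⟨π, ⟨hB, hC, hBp, hCp, hrel⟩, hid⟩ :=
    e3_dichotomy_id Finset.univ Xn Sn hXn hSn (by simp) b b' c c' hsum'
  have hsumπ := hsum_letterPerm π Finset.univ Xn b b' c c' hsum'
  simp only [Fin.sum_univ_three] at hsumπ hid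
  exact profile_211s_of_shape (fun x => f (π x)) (fun y i j => H (π y) (π i) (π j))
    (fun x y => g₀ (π x) (π y)) (fun i j => h₀ (π i) (π j)) (fun x y => g₁ (π x) (π y)) (fun i j => h₁ (π i) (π j))
    (fun x z => b (π x) (π z)) (fun y w => b' (π y) (π w)) (fun x w => c (π x) (π w)) (fun y z => c' (π y) (π z))
    (fun v => by rw [hsumπ v]; rfl) (fun φ => by rw [← hid φ]; rfl) hB hC hBp hCp hrel

end LaplaceFourLine

end Summit.ValiantsHypothesis.ValiantsHypothesis.Theorems.RigidityForcesSymmetryRankRigidMinimalRepr
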